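import Summits.ValiantsHypothesis.ValiantsHypothesis.Theorems.GrenetZeonDualUnipotentThreeHalvesHeavyTopInstFourSevenBlocks

/-!
# `GrenetZeon.DualUnipotentThreeHalves` (stmt-ValiantsHypothesis-24318) — line «radical_split» §8, instance table of R2:
# BUDGET ONE IS IMPOSSIBLE for the far-corner `(4,7)` pencil (`dim K > 8`, `Q² = 0`, `QPQ = 0` ⇒ `dim K ≤ 8`)

24318 `HeavyTopLaw` INSTRUMENT (director-valiant g13 R259 (a) / R263; the cut named by the instrument pen val-port-3 g2, 15:14Z:
«the (4,7) far-corner NEGATIVE certificate on the ✓ p635270 template — word certificates of length ≤ 3»; this file val-port-2 g2,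
val-lit merged desk b71 (B) port pool).  Part of the chain `…GrenetZeonDualUnipotentThreeHalvesHeavyTopInstFourSeven{Defs, Toolkit, Blocks, BudgetOne}` (flat helper files) →
`…DualUnipotentThreeHalves/Negative/HeavyTopInstFourSeven` (`¬ HeavyTopInst 4 7`, Negative lane).

* ★★ `no_wordTame_one_NSeven` — no direction space `K ≤ ℂ^{4×4}` of dimension `> 8` has every pair `(topSeven x, topSeven v)`,
  `v ∈ K`, word-tame with budget `1` at `n = 4`: the profile forces `Q² = 0` (✓ `pow_eq_zero_of_wordTame`) and `Q·P·Q = 0` for every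
  `P` in the top space (✓ `not_wordTame_of_word` on the word `T₁T₀T₁`); the seven pivot dichotomies (✓ `budgetOne_blocks`) and the
  isolated two-paths of `Q² = 0` (✓ `budgetOne_squares`) give a decision tree with sixteen leaves, each carrying `≥ 8` dead
  coordinates, i.e. `dim K ≤ 8` (✓ `finrank_add_length_le_of_forall_apply_eq_zero`).  The tree was found by exhaustive search
  (max consistent coordinate envelope `= 7`) and is replayed here by hand.

Honest framing.  Helper lemmas for ONE tiny format of R2's instance table (`--supports stmt-ValiantsHypothesis-24318 --as helper`);
nothing here asserts or refutes R2 `HeavyTopLaw` (take `n₀ ≥ 5` or `C₀ ≥ 2` and `(4,7)` is discarded), S3b, the crux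
`DualUnipotentThreeHalves`, rung 8062 or `VP ≠ VNP` — all OPEN / NOT proved.
[this line's workfile §8; port-3 g2 `Cruxes/DualUnipotentThreeHalves/INSTANCES.md` v1 (5); ✓ `…Negative.HeavyTopInstThreeFive`; ✓ `…WordFlagPencil`]
-/

-- `Summit.ValiantsHypothesis.ValiantsHypothesis.…` repeats a component (D-0017 layout); `dupNamespace` would flag the mandated name.
set_option linter.dupNamespace false
set_option autoImplicit false

noncomputable section

namespace Summit.ValiantsHypothesis.ValiantsHypothesis.Theorems.GrenetZeon.RadicalSplit

open MvPolynomial Matrix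
open scoped BigOperators
open Summit.ValiantsHypothesis.ValiantsHypothesis.Cruxes.TwoDimCoefficients.DimTwoCases (AffMat IsAffine)

/-- **Budget `1` is impossible for the far-corner `(4,7)` pencil**: no direction space `K` of dimension `> 8` has every pair
`(topSeven x, topSeven v)`, `v ∈ K`, word-tame with budget `1`.  The profile forces `Q² = 0` and `Q·P·Q = 0` for every top
`Q = topSeven v`, `v ∈ K`, and EVERY `P` in the top space; with `P = E_{ab}` this kills, for each of seven pivots `(a,b)`, the whole
column `a` or the whole row `b` among `K`'s sixteen coordinates, and `Q² = 0` kills one factor of every isolated length-two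
path; sixteen leaves, each with `≥ 8` dead coordinates, i.e. `dim K ≤ 8`. [this file] -/
theorem no_wordTame_one_NSeven (K : Submodule ℂ (Fin 4 × Fin 4 → ℂ)) (hdim : 8 < Module.finrank ℂ K)
    (hW : ∀ x v : Fin 4 × Fin 4 → ℂ, v ∈ K → WordTame 4 1 (topSeven x) (topSeven v)) : False := by
  classical
  have hcard : Fintype.card (Fin 4 × Fin 4) = 16 := by simp
  -- squares of tops vanish on K
  have hsq : ∀ v ∈ K, topSeven v * topSeven v = 0 := fun v hv => by
    have h := pow_eq_zero_of_wordTame (by norm_num) _ _ (hW 0 v hv)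
    simpa [pow_succ] using h
  -- the word T₁T₀T₁ vanishes for every T₀ in the top space
  have hqpq : ∀ x, ∀ v ∈ K, topSeven v * topSeven x * topSeven v = 0 := fun x v hv => by
    by_contra hne
    exact not_wordTame_of_word (topSeven x) (topSeven v) [true, false, true]
      (by simpa [word, Matrix.mul_assoc] using hne) (by simp) (by simp) (hW x v hv)
  obtain ⟨blk23, blk24, blk34, blk35, blk45, blk46, blk56⟩ := budgetOne_blocks K hqpq
  obtain ⟨sq14, sq15, sq16, sq25⟩ := budgetOne_squares K hsq
  -- the decision tree (16 leaves)
  rcases blk34 with hC | hR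
  · have dy1 : ∀ v ∈ K, v (0,1) = 0 := by simpa using hC 0
    have dx2 : ∀ v ∈ K, v (1,0) = 0 := by simpa using hC 1
    rcases blk45 with hC | hR
    · have dz1 : ∀ v ∈ K, v (0,2) = 0 := by simpa using hC 0
      have dy2 : ∀ v ∈ K, v (1,1) = 0 := by simpa using hC 1
      have dx3 : ∀ v ∈ K, v (2,0) = 0 := by simpa using hC 2
      rcases blk56 with hC | hR
      · have dw1 : ∀ v ∈ K, v (0,3) = 0 := by simpa using hC 0
        have dz2 : ∀ v ∈ K, v (1,2) = 0 := by simpa using hC 1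
        have dy3 : ∀ v ∈ K, v (2,1) = 0 := by simpa using hC 2
        have dx4 : ∀ v ∈ K, v (3,0) = 0 := by simpa using hC 3
        have hle := finrank_add_length_le_of_forall_apply_eq_zero K [(0,1), (0,2), (0,3), (1,0), (1,1), (1,2), (2,0), (2,1), (3,0)] (by decide) (by
          intro v hv c hc
          simp only [List.mem_cons, List.mem_nil_iff, or_false] at hc
          rcases hc with rfl | rfl | rfl | rfl | rfl | rfl | rfl | rfl | rfl
          · exact dy1 v hv
          · exact dz1 v hv
          · exact dw1 v hv
          · exact dx2 v hv
          · exact dy2 v hv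
          · exact dz2 v hv
          · exact dx3 v hv
          · exact dy3 v hv
          · exact dx4 v hv
          )
        simp only [List.length_cons, List.length_nil] at hle
        omega
      · have dx6 : ∀ v ∈ K, v (3,3) = 0 := by simpa using hR 0
        rcases blk24 with hC | hR
        · have dx1 : ∀ v ∈ K, v (0,0) = 0 := by simpa using hC 0
          have hp : ∀ v ∈ K, v (0,3) * v (1,3) = 0 := fun v hv => by
            have h := sq16 v hv
            rw [dy1 v hv, dz1 v hv] at h
            simpa using h
          rcases forall_apply_eq_zero_or K (0,3) (1,3) hp with dw1 | dx5
          · have hle := finrank_add_length_le_of_forall_apply_eq_zero K [(0,0), (0,1), (0,2), (0,3), (1,0), (1,1), (2,0), (3,3)] (by decide) (by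
              intro v hv c hc
              simp only [List.mem_cons, List.mem_nil_iff, or_false] at hc
              rcases hc with rfl | rfl | rfl | rfl | rfl | rfl | rfl | rfl
              · exact dx1 v hv
              · exact dy1 v hv
              · exact dz1 v hv
              · exact dw1 v hv
              · exact dx2 v hv
              · exact dy2 v hv
              · exact dx3 v hv
              · exact dx6 v hv
              )
            simp only [List.length_cons, List.length_nil] at hle
            omega
          · have hle := finrank_add_length_le_of_forall_apply_eq_zero K [(0,0), (0,1), (0,2), (1,0), (1,1), (1,3), (2,0), (3,3)] (by decide) (by
              intro v hv c hc
              simp only [List.mem_cons, List.mem_nil_iff, or_false] at hc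
              rcases hc with rfl | rfl | rfl | rfl | rfl | rfl | rfl | rfl
              · exact dx1 v hv
              · exact dy1 v hv
              · exact dz1 v hv
              · exact dx2 v hv
              · exact dy2 v hv
              · exact dx5 v hv
              · exact dx3 v hv
              · exact dx6 v hv
              )
            simp only [List.length_cons, List.length_nil] at hle
            omega
        · have dx4 : ∀ v ∈ K, v (3,0) = 0 := by simpa using hR 0
          have dy4 : ∀ v ∈ K, v (3,1) = 0 := by simpa using hR 1
          have dz4 : ∀ v ∈ K, v (3,2) = 0 := by simpa using hR 2
          have hle := finrank_add_length_le_of_forall_apply_eq_zero K [(0,1), (0,2), (1,0), (1,1), (2,0), (3,0), (3,1), (3,2), (3,3)] (by decide) (by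
            intro v hv c hc
            simp only [List.mem_cons, List.mem_nil_iff, or_false] at hc
            rcases hc with rfl | rfl | rfl | rfl | rfl | rfl | rfl | rfl | rfl
            · exact dy1 v hv
            · exact dz1 v hv
            · exact dx2 v hv
            · exact dy2 v hv
            · exact dx3 v hv
            · exact dx4 v hv
            · exact dy4 v hv
            · exact dz4 v hv
            · exact dx6 v hv
            )
          simp only [List.length_cons, List.length_nil] at hle
          omega
    · have dx5 : ∀ v ∈ K, v (1,3) = 0 := by simpa using hR 0
      have dy5 : ∀ v ∈ K, v (2,3) = 0 := by simpa using hR 1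
      rcases blk56 with hC | hR
      · have dw1 : ∀ v ∈ K, v (0,3) = 0 := by simpa using hC 0
        have dz2 : ∀ v ∈ K, v (1,2) = 0 := by simpa using hC 1
        have dy3 : ∀ v ∈ K, v (2,1) = 0 := by simpa using hC 2
        have dx4 : ∀ v ∈ K, v (3,0) = 0 := by simpa using hC 3
        have hle := finrank_add_length_le_of_forall_apply_eq_zero K [(0,1), (0,3), (1,0), (1,2), (1,3), (2,1), (2,3), (3,0)] (by decide) (by
          intro v hv c hc
          simp only [List.mem_cons, List.mem_nil_iff, or_false] at hc
          rcases hc with rfl | rfl | rfl | rfl | rfl | rfl | rfl | rfl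
          · exact dy1 v hv
          · exact dw1 v hv
          · exact dx2 v hv
          · exact dz2 v hv
          · exact dx5 v hv
          · exact dy3 v hv
          · exact dy5 v hv
          · exact dx4 v hv
          )
        simp only [List.length_cons, List.length_nil] at hle
        omega
      · have dx6 : ∀ v ∈ K, v (3,3) = 0 := by simpa using hR 0
        rcases blk23 with hC | hR
        · have dx1 : ∀ v ∈ K, v (0,0) = 0 := by simpa using hC 0
          have hp : ∀ v ∈ K, v (0,2) * v (3,0) = 0 := fun v hv => by
            have h := sq15 v hv
            rw [dx1 v hv, dy1 v hv] at h
            simpa using h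
          rcases forall_apply_eq_zero_or K (0,2) (3,0) hp with dz1 | dx4
          · have hp : ∀ v ∈ K, v (1,1) * v (3,0) = 0 := fun v hv => by
              have h := sq25 v hv
              rw [dx2 v hv] at h
              simpa using h
            rcases forall_apply_eq_zero_or K (1,1) (3,0) hp with dy2 | dx4
            · have hle := finrank_add_length_le_of_forall_apply_eq_zero K [(0,0), (0,1), (0,2), (1,0), (1,1), (1,3), (2,3), (3,3)] (by decide) (by
                intro v hv c hc
                simp only [List.mem_cons, List.mem_nil_iff, or_false] at hc
                rcases hc with rfl | rfl | rfl | rfl | rfl | rfl | rfl | rfl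
                · exact dx1 v hv
                · exact dy1 v hv
                · exact dz1 v hv
                · exact dx2 v hv
                · exact dy2 v hv
                · exact dx5 v hv
                · exact dy5 v hv
                · exact dx6 v hv
                )
              simp only [List.length_cons, List.length_nil] at hle
              omega
            · have hle := finrank_add_length_le_of_forall_apply_eq_zero K [(0,0), (0,1), (0,2), (1,0), (1,3), (2,3), (3,0), (3,3)] (by decide) (by
                intro v hv c hc
                simp only [List.mem_cons, List.mem_nil_iff, or_false] at hc
                rcases hc with rfl | rfl | rfl | rfl | rfl | rfl | rfl | rfl
                · exact dx1 v hv
                · exact dy1 v hv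
                · exact dz1 v hv
                · exact dx2 v hv
                · exact dx5 v hv
                · exact dy5 v hv
                · exact dx4 v hv
                · exact dx6 v hv
                )
              simp only [List.length_cons, List.length_nil] at hle
              omega
          · have hp : ∀ v ∈ K, v (0,2) * v (3,1) = 0 := fun v hv => by
              have h := sq16 v hv
              rw [dy1 v hv, dx5 v hv] at h
              simpa using h
            rcases forall_apply_eq_zero_or K (0,2) (3,1) hp with dz1 | dy4
            · have hle := finrank_add_length_le_of_forall_apply_eq_zero K [(0,0), (0,1), (0,2), (1,0), (1,3), (2,3), (3,0), (3,3)] (by decide) (by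
                intro v hv c hc
                simp only [List.mem_cons, List.mem_nil_iff, or_false] at hc
                rcases hc with rfl | rfl | rfl | rfl | rfl | rfl | rfl | rfl
                · exact dx1 v hv
                · exact dy1 v hv
                · exact dz1 v hv
                · exact dx2 v hv
                · exact dx5 v hv
                · exact dy5 v hv
                · exact dx4 v hv
                · exact dx6 v hv
                )
              simp only [List.length_cons, List.length_nil] at hle
              omega
            · have hle := finrank_add_length_le_of_forall_apply_eq_zero K [(0,0), (0,1), (1,0), (1,3), (2,3), (3,0), (3,1), (3,3)] (by decide) (by
                intro v hv c hc
                simp only [List.mem_cons, List.mem_nil_iff, or_false] at hc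
                rcases hc with rfl | rfl | rfl | rfl | rfl | rfl | rfl | rfl
                · exact dx1 v hv
                · exact dy1 v hv
                · exact dx2 v hv
                · exact dx5 v hv
                · exact dy5 v hv
                · exact dx4 v hv
                · exact dy4 v hv
                · exact dx6 v hv
                )
              simp only [List.length_cons, List.length_nil] at hle
              omega
        · have dx3 : ∀ v ∈ K, v (2,0) = 0 := by simpa using hR 0
          have dy3 : ∀ v ∈ K, v (2,1) = 0 := by simpa using hR 1
          have dz3 : ∀ v ∈ K, v (2,2) = 0 := by simpa using hR 2
          have hle := finrank_add_length_le_of_forall_apply_eq_zero K [(0,1), (1,0), (1,3), (2,0), (2,1), (2,2), (2,3), (3,3)] (by decide) (by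
            intro v hv c hc
            simp only [List.mem_cons, List.mem_nil_iff, or_false] at hc
            rcases hc with rfl | rfl | rfl | rfl | rfl | rfl | rfl | rfl
            · exact dy1 v hv
            · exact dx2 v hv
            · exact dx5 v hv
            · exact dx3 v hv
            · exact dy3 v hv
            · exact dz3 v hv
            · exact dy5 v hv
            · exact dx6 v hv
            )
          simp only [List.length_cons, List.length_nil] at hle
          omega
  · have dx4 : ∀ v ∈ K, v (3,0) = 0 := by simpa using hR 0
    have dy4 : ∀ v ∈ K, v (3,1) = 0 := by simpa using hR 1
    have dz4 : ∀ v ∈ K, v (3,2) = 0 := by simpa using hR 2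
    rcases blk45 with hC | hR
    · have dz1 : ∀ v ∈ K, v (0,2) = 0 := by simpa using hC 0
      have dy2 : ∀ v ∈ K, v (1,1) = 0 := by simpa using hC 1
      have dx3 : ∀ v ∈ K, v (2,0) = 0 := by simpa using hC 2
      rcases blk35 with hC | hR
      · have dy1 : ∀ v ∈ K, v (0,1) = 0 := by simpa using hC 0
        have dx2 : ∀ v ∈ K, v (1,0) = 0 := by simpa using hC 1
        have hle := finrank_add_length_le_of_forall_apply_eq_zero K [(0,1), (0,2), (1,0), (1,1), (2,0), (3,0), (3,1), (3,2)] (by decide) (by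
          intro v hv c hc
          simp only [List.mem_cons, List.mem_nil_iff, or_false] at hc
          rcases hc with rfl | rfl | rfl | rfl | rfl | rfl | rfl | rfl
          · exact dy1 v hv
          · exact dz1 v hv
          · exact dx2 v hv
          · exact dy2 v hv
          · exact dx3 v hv
          · exact dx4 v hv
          · exact dy4 v hv
          · exact dz4 v hv
          )
        simp only [List.length_cons, List.length_nil] at hle
        omega
      · have dx5 : ∀ v ∈ K, v (1,3) = 0 := by simpa using hR 0
        have dy5 : ∀ v ∈ K, v (2,3) = 0 := by simpa using hR 1
        have hle := finrank_add_length_le_of_forall_apply_eq_zero K [(0,2), (1,1), (1,3), (2,0), (2,3), (3,0), (3,1), (3,2)] (by decide) (by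
          intro v hv c hc
          simp only [List.mem_cons, List.mem_nil_iff, or_false] at hc
          rcases hc with rfl | rfl | rfl | rfl | rfl | rfl | rfl | rfl
          · exact dz1 v hv
          · exact dy2 v hv
          · exact dx5 v hv
          · exact dx3 v hv
          · exact dy5 v hv
          · exact dx4 v hv
          · exact dy4 v hv
          · exact dz4 v hv
          )
        simp only [List.length_cons, List.length_nil] at hle
        omega
    · have dx5 : ∀ v ∈ K, v (1,3) = 0 := by simpa using hR 0
      have dy5 : ∀ v ∈ K, v (2,3) = 0 := by simpa using hR 1
      rcases blk23 with hC | hR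
      · have dx1 : ∀ v ∈ K, v (0,0) = 0 := by simpa using hC 0
        rcases blk46 with hC | hR
        · have dz1 : ∀ v ∈ K, v (0,2) = 0 := by simpa using hC 0
          have dy2 : ∀ v ∈ K, v (1,1) = 0 := by simpa using hC 1
          have dx3 : ∀ v ∈ K, v (2,0) = 0 := by simpa using hC 2
          have hle := finrank_add_length_le_of_forall_apply_eq_zero K [(0,0), (0,2), (1,1), (1,3), (2,0), (2,3), (3,0), (3,1), (3,2)] (by decide) (by
            intro v hv c hc
            simp only [List.mem_cons, List.mem_nil_iff, or_false] at hc
            rcases hc with rfl | rfl | rfl | rfl | rfl | rfl | rfl | rfl | rfl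
            · exact dx1 v hv
            · exact dz1 v hv
            · exact dy2 v hv
            · exact dx5 v hv
            · exact dx3 v hv
            · exact dy5 v hv
            · exact dx4 v hv
            · exact dy4 v hv
            · exact dz4 v hv
            )
          simp only [List.length_cons, List.length_nil] at hle
          omega
        · have dx6 : ∀ v ∈ K, v (3,3) = 0 := by simpa using hR 0
          have hp : ∀ v ∈ K, v (0,1) * v (2,0) = 0 := fun v hv => by
            have h := sq14 v hv
            rw [dx1 v hv] at h
            simpa using h
          rcases forall_apply_eq_zero_or K (0,1) (2,0) hp with dy1 | dx3
          · have hle := finrank_add_length_le_of_forall_apply_eq_zero K [(0,0), (0,1), (1,3), (2,3), (3,0), (3,1), (3,2), (3,3)] (by decide) (by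
              intro v hv c hc
              simp only [List.mem_cons, List.mem_nil_iff, or_false] at hc
              rcases hc with rfl | rfl | rfl | rfl | rfl | rfl | rfl | rfl
              · exact dx1 v hv
              · exact dy1 v hv
              · exact dx5 v hv
              · exact dy5 v hv
              · exact dx4 v hv
              · exact dy4 v hv
              · exact dz4 v hv
              · exact dx6 v hv
              )
            simp only [List.length_cons, List.length_nil] at hle
            omega
          · have hle := finrank_add_length_le_of_forall_apply_eq_zero K [(0,0), (1,3), (2,0), (2,3), (3,0), (3,1), (3,2), (3,3)] (by decide) (by
              intro v hv c hc
              simp only [List.mem_cons, List.mem_nil_iff, or_false] at hc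
              rcases hc with rfl | rfl | rfl | rfl | rfl | rfl | rfl | rfl
              · exact dx1 v hv
              · exact dx5 v hv
              · exact dx3 v hv
              · exact dy5 v hv
              · exact dx4 v hv
              · exact dy4 v hv
              · exact dz4 v hv
              · exact dx6 v hv
              )
            simp only [List.length_cons, List.length_nil] at hle
            omega
      · have dx3 : ∀ v ∈ K, v (2,0) = 0 := by simpa using hR 0
        have dy3 : ∀ v ∈ K, v (2,1) = 0 := by simpa using hR 1
        have dz3 : ∀ v ∈ K, v (2,2) = 0 := by simpa using hR 2
        have hle := finrank_add_length_le_of_forall_apply_eq_zero K [(1,3), (2,0), (2,1), (2,2), (2,3), (3,0), (3,1), (3,2)] (by decide) (by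
          intro v hv c hc
          simp only [List.mem_cons, List.mem_nil_iff, or_false] at hc
          rcases hc with rfl | rfl | rfl | rfl | rfl | rfl | rfl | rfl
          · exact dx5 v hv
          · exact dx3 v hv
          · exact dy3 v hv
          · exact dz3 v hv
          · exact dy5 v hv
          · exact dx4 v hv
          · exact dy4 v hv
          · exact dz4 v hv
          )
        simp only [List.length_cons, List.length_nil] at hle
        omega

end Summit.ValiantsHypothesis.ValiantsHypothesis.Theorems.GrenetZeon.RadicalSplit

end
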